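import Mathlib
import Literature.Geometry.Manifold.TranslationFlow
import Literature.Geometry.Manifold.SubmersionLift
import Literature.Geometry.Manifold.OpenSubmanifoldMFDeriv
import Literature.Topology.FourManifolds.MorseProofs
import Literature.Geometry.Symplectic.McleanDivisorComplementConvexFour
import HarnessLib

/-!
# High sublevel sets of an exhausting function without high critical points are connected

Topic `Literature/Geometry/Symplectic` (discharge of the named fact
`Literature.Geometry.Symplectic.isPreconnected_sublevel_of_forall_mfderiv_ne_zero` of
`McleanDivisorComplementConvexFour.lean`, the topological input of the Liouville packaging of
divisor complements; J. Milnor, *Morse theory* (1963), Thm. 3.1: "`Mᵃ` is a deformation retract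
of `Mᵇ`" when `f⁻¹[a, b]` is compact without critical points).  Everything here is PROVED.

**Statement.** `M` a connected `C^∞` `n`-manifold without boundary (Hausdorff, second
countable), `g : M → ℝ` smooth with compact sublevel sets and `dg_x ≠ 0` whenever `g x ≥ C`.
Then `{g ≤ c}` is preconnected for every `c ≥ C`.

**Proof** (Milnor's retraction, with the tree's flow machinery).  First lower `C` slightly: the
critical set is closed (`Literature.Topology.FourManifolds.isClosed_criticalSet_of_contMDiff`),
so its part in the compact slab `{C - 1 ≤ g ≤ C}` is compact and `g < C` on it, whence some
`C' < C` below which nothing changes (`exists_lt_forall_mfderiv_ne_zero`); thus we may assume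
`dg ≠ 0` on the OPEN set `O = {C < g}` and `c > C`.  On the open submanifold `O` the height
`h = log (g - C)` is smooth, proper (`h⁻¹[a, b] = g⁻¹[C + eᵃ, C + eᵇ]`) and without critical
points, so it is translated by the complete flow `θ` of a smooth field `V` with `dh(V) = 1`
(`Literature.Geometry.Manifold.exists_contMDiff_lift_of_surjective_mfderiv`,
`Literature.Geometry.Manifold.exists_globalFlow_of_lift`, Bröcker–Jänich (8.12)).  The map
`r : M → M`, `r y = θ(min (0, log (c - C) - h y), y)` on `O` and `r y = y` on `{g < c}` (the two
formulas agree on the overlap), is continuous, is the identity on `{g ≤ c}` and takes values in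
`{g ≤ c}`; hence `{g ≤ c} = r(M)` is preconnected, `M` being connected.

## References

* J. Milnor, *Morse theory*, Ann. of Math. Studies 51 (1963), Thm. 3.1 and Remark 3.4.
  [MilnorMorseTheory1963]
* Th. Bröcker, K. Jänich, *Introduction to Differential Topology* (1982), (8.12).
  [BrockerJanichIDT1982]
-/

noncomputable section

open scoped _root_.Manifold _root_.ContDiff _root_.Topology
open _root_.Set _root_.Function _root_.Filter _root_.Metric

namespace Literature.Geometry.Symplectic

variable {n : ℕ} {M : Type} [TopologicalSpace M] [T2Space M] [SecondCountableTopology M]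
  [ChartedSpace (EuclideanSpace ℝ (Fin n)) M] [IsManifold (𝓡 n) ∞ M] {g : M → ℝ} {C : ℝ}

omit [T2Space M] [SecondCountableTopology M] in
/-- **Room below a regular range.** If `g` is smooth with compact sublevel sets and has no
critical point on `{g ≥ C}`, then it has none on `{g > C'}` for some `C' < C` (the critical set
is closed, its trace on the compact slab `{C - 1 ≤ g ≤ C}` is compact and carries values `< C`).
[folklore] -/
theorem exists_lt_forall_mfderiv_ne_zero (hg : ContMDiff (𝓡 n) 𝓘(ℝ, ℝ) ∞ g)
    (hK : ∀ c, IsCompact (g ⁻¹' Iic c)) (hreg : ∀ x, C ≤ g x → mfderiv (𝓡 n) 𝓘(ℝ, ℝ) g x ≠ 0) :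
    ∃ C' < C, ∀ x, C' < g x → mfderiv (𝓡 n) 𝓘(ℝ, ℝ) g x ≠ 0 := by
  set Z : Set M := Literature.Topology.FourManifolds.criticalSet (𝓡 n) g ∩ g ⁻¹' Icc (C - 1) C
    with hZ
  have hZc : IsCompact Z :=
    (hK C).of_isClosed_subset
      ((Literature.Topology.FourManifolds.isClosed_criticalSet_of_contMDiff hg (by norm_cast)).inter
        (isClosed_Icc.preimage hg.continuous)) fun x hx => hx.2.2
  rcases Z.eq_empty_or_nonempty with hZe | hZne
  · refine ⟨C - 1, by linarith, fun x hx h0 => ?_⟩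
    by_cases hxC : C ≤ g x
    · exact hreg x hxC h0
    · have hxZ : x ∈ Z := ⟨h0, hx.le, (not_le.1 hxC).le⟩
      rw [hZe] at hxZ
      exact hxZ
  · obtain ⟨x₀, hx₀Z, hmax⟩ := hZc.exists_isMaxOn hZne hg.continuous.continuousOn
    have hm : g x₀ < C := lt_of_not_ge fun h => hreg x₀ h hx₀Z.1
    refine ⟨max (g x₀) (C - 1), max_lt hm (by linarith), fun x hx h0 => ?_⟩
    by_cases hxC : C ≤ g x
    · exact hreg x hxC h0
    · have hxZ : x ∈ Z := ⟨h0, (le_max_right _ _).trans hx.le, (not_le.1 hxC).le⟩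
      exact absurd (hmax hxZ) (not_le.2 ((le_max_left _ _).trans_lt hx))

/-- **Milnor's retraction onto a high sublevel set** (Morse theory, Thm. 3.1, for the open
piece `{C < g}` of a connected manifold): if `g` is smooth with compact sublevel sets and without
critical points on `{C < g}`, then `{g ≤ c}` is preconnected for every `c > C` — it is the image
of `M` under the continuous retraction that flows `{g ≥ c}` down to the level `c` along a field
translating `log (g - C)`. [cite: MilnorMorseTheory1963, Thm. 3.1] -/
theorem isPreconnected_preimage_Iic_of_lt [ConnectedSpace M] (hg : ContMDiff (𝓡 n) 𝓘(ℝ, ℝ) ∞ g)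
    (hK : ∀ c, IsCompact (g ⁻¹' Iic c)) (hreg : ∀ x, C < g x → mfderiv (𝓡 n) 𝓘(ℝ, ℝ) g x ≠ 0)
    {c : ℝ} (hc : C < c) : IsPreconnected (g ⁻¹' Iic c) := by
  -- the open piece `O = {C < g}`
  let O : TopologicalSpace.Opens M := ⟨{x | C < g x}, isOpen_lt continuous_const hg.continuous⟩
  haveI : LocallyCompactSpace O :=
    ChartedSpace.locallyCompactSpace (EuclideanSpace ℝ (Fin n)) O
  have hpos : ∀ y : O, 0 < g y.1 - C := fun y => sub_pos.2 y.2
  -- the height `h = log (g - C)` on `O`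
  set h : O → ℝ := fun y => Real.log (g y.1 - C) with hh_def
  have hGs : ContMDiff (𝓡 n) 𝓘(ℝ, ℝ) ∞ fun y : O => g y.1 := hg.comp contMDiff_subtype_val
  have hφ : ∀ t, C < t → HasDerivAt (fun t => Real.log (t - C)) (1 / (t - C)) t := fun t ht =>
    ((hasDerivAt_id t).sub_const C).log (sub_pos.2 ht).ne'
  have hhs : ContMDiff (𝓡 n) 𝓘(ℝ, ℝ) ∞ h := by
    intro y
    have h1 : ContDiffAt ℝ ∞ (fun t => Real.log (t - C)) (g y.1) :=
      (contDiffAt_id.sub contDiffAt_const).log (hpos y).ne'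
    exact h1.contMDiffAt.comp_of_eq (hGs y) rfl
  -- `dh ≠ 0`, hence `dh` is onto `ℝ`
  have hdh : ∀ y, Surjective (mfderiv (𝓡 n) 𝓘(ℝ, ℝ) h y) := by
    intro y
    set L : EuclideanSpace ℝ (Fin n) →L[ℝ] ℝ := mfderiv (𝓡 n) 𝓘(ℝ, ℝ) h y with hL
    suffices hex : ∃ v, L v ≠ 0 by
      obtain ⟨v, hv⟩ := hex
      show Surjective L
      intro r
      refine ⟨(r / L v) • v, ?_⟩
      rw [map_smul, smul_eq_mul, div_mul_cancel₀ r hv]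
    set Dg : EuclideanSpace ℝ (Fin n) →L[ℝ] ℝ := mfderiv (𝓡 n) 𝓘(ℝ, ℝ) g y.1 with hDg
    obtain ⟨v, hv⟩ : ∃ v, Dg v ≠ 0 := by
      by_contra hcon
      push Not at hcon
      exact hreg y.1 y.2 (ContinuousLinearMap.ext hcon)
    have h1 : HasMFDerivAt (𝓡 n) (𝓡 n) (Subtype.val : O → M) y
        (ContinuousLinearMap.id ℝ (EuclideanSpace ℝ (Fin n))) :=
      Literature.Geometry.Manifold.OpenSubmanifold.hasMFDerivAt_subtype_val y
    have h2 : HasMFDerivAt (𝓡 n) 𝓘(ℝ, ℝ) g y.1 Dg :=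
      (hg.mdifferentiableAt (by simp)).hasMFDerivAt
    have h3 : HasMFDerivAt 𝓘(ℝ, ℝ) 𝓘(ℝ, ℝ) (fun t => Real.log (t - C)) (g y.1)
        ((1 : ℝ →L[ℝ] ℝ).smulRight (1 / (g y.1 - C))) :=
      (hφ _ y.2).hasFDerivAt.hasMFDerivAt
    have h4 : HasMFDerivAt (𝓡 n) 𝓘(ℝ, ℝ) h y
        (((1 : ℝ →L[ℝ] ℝ).smulRight (1 / (g y.1 - C))).comp
          (Dg.comp (ContinuousLinearMap.id ℝ (EuclideanSpace ℝ (Fin n))))) :=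
      h3.comp y (h2.comp y h1)
    refine ⟨v, ?_⟩
    rw [hL, h4.mfderiv]
    show Dg v * (1 / (g y.1 - C)) ≠ 0
    exact mul_ne_zero hv (one_div_ne_zero (hpos y).ne')
  -- properness of `h`: `h⁻¹[a, b] = g⁻¹[C + eᵃ, C + eᵇ]`
  have hballs : ∀ (u R : ℝ), IsCompact (h ⁻¹' closedBall u R) := by
    intro u R
    set K₀ : Set M := g ⁻¹' Icc (C + Real.exp (u - R)) (C + Real.exp (u + R)) with hK₀
    have hK₀c : IsCompact K₀ :=
      (hK _).of_isClosed_subset (isClosed_Icc.preimage hg.continuous) fun x hx => hx.2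
    have hK₀O : K₀ ⊆ (O : Set M) := fun x hx =>
      show C < g x from lt_of_lt_of_le (lt_add_of_pos_right C (Real.exp_pos _)) hx.1
    have hpre : h ⁻¹' closedBall u R = (Subtype.val : O → M) ⁻¹' K₀ := by
      ext y
      simp only [mem_preimage, mem_closedBall, Real.dist_eq, abs_sub_le_iff, hK₀, mem_Icc,
        hh_def, sub_le_iff_le_add]
      constructor
      · rintro ⟨ha, hb⟩
        refine ⟨?_, ?_⟩
        · have := Real.exp_le_exp.2 (show u - R ≤ Real.log (g y.1 - C) by linarith)
          rw [Real.exp_log (hpos y)] at this; linarith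
        · have := Real.exp_le_exp.2 (show Real.log (g y.1 - C) ≤ u + R by linarith)
          rw [Real.exp_log (hpos y)] at this; linarith
      · rintro ⟨ha, hb⟩
        have ha' : Real.log (Real.exp (u - R)) ≤ Real.log (g y.1 - C) :=
          Real.log_le_log (Real.exp_pos _) (by linarith)
        have hb' : Real.log (g y.1 - C) ≤ Real.log (Real.exp (u + R)) :=
          Real.log_le_log (hpos y) (by linarith)
        rw [Real.log_exp] at ha' hb'
        constructor <;> linarith
    rw [hpre, Topology.IsEmbedding.subtypeVal.isCompact_iff, image_preimage_eq_inter_range,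
      Subtype.range_coe_subtype]
    have hKO : K₀ ∩ {x | x ∈ O} = K₀ := inter_eq_left.2 fun x hx => hK₀O hx
    rw [hKO]
    exact hK₀c
  -- the translating field and its complete flow (Bröcker–Jänich (8.12))
  obtain ⟨V, hV, hV1⟩ :=
    Literature.Geometry.Manifold.exists_contMDiff_lift_of_surjective_mfderiv hhs hdh (1 : ℝ)
  obtain ⟨θ, hθs, hθ0, -, -, hθh⟩ :=
    Literature.Geometry.Manifold.exists_globalFlow_of_lift hhs hV hV1 hballs
  simp only [smul_eq_mul, mul_one] at hθh
  -- the retraction `r`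
  classical
  set sc : ℝ := Real.log (c - C) with hsc
  set r : M → M := fun y =>
    if hy : C < g y then (θ (min 0 (sc - h ⟨y, hy⟩), ⟨y, hy⟩)).1 else y with hr_def
  have hrO : ∀ y : O, r y.1 = (θ (min 0 (sc - h y), y)).1 := fun y => by
    rw [hr_def]
    simp only [dif_pos (show C < g y.1 from y.2)]
  have hr_le : ∀ y, g (r y) ≤ c := by
    intro y
    by_cases hy : C < g y
    · set p : O := θ (min 0 (sc - h ⟨y, hy⟩), ⟨y, hy⟩) with hp
      have h1 : r y = p.1 := hrO ⟨y, hy⟩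
      have h2 : h p ≤ sc := by
        rw [hp, hθh]
        have := min_le_right (0 : ℝ) (sc - h ⟨y, hy⟩)
        linarith
      have h3 : g p.1 - C ≤ c - C := (Real.log_le_log_iff (hpos p) (sub_pos.2 hc)).1 h2
      rw [h1]
      linarith
    · rw [hr_def]
      simp only [dif_neg hy]
      linarith [not_lt.1 hy]
  have hr_id : ∀ y, g y ≤ c → r y = y := by
    intro y hyc
    by_cases hy : C < g y
    · rw [hrO ⟨y, hy⟩]
      have h1 : h ⟨y, hy⟩ ≤ sc := Real.log_le_log (hpos ⟨y, hy⟩) (by linarith)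
      have h2 : min 0 (sc - h ⟨y, hy⟩) = 0 := min_eq_left (by linarith)
      rw [h2, hθ0]
    · rw [hr_def]
      simp only [dif_neg hy]
  have hr_cont : Continuous r := by
    rw [continuous_iff_continuousAt]
    intro y
    by_cases hy : C < g y
    · -- near `y`, `r ∘ val = val ∘ Θ` on the open set `O`
      have hΘ : Continuous fun p : O => (θ (min 0 (sc - h p), p)).1 :=
        continuous_subtype_val.comp (hθs.continuous.comp
          ((continuous_const.min (continuous_const.sub hhs.continuous)).prodMk continuous_id))
      have key : ContinuousAt (r ∘ (Subtype.val : O → M)) ⟨y, hy⟩ := by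
        have heq : r ∘ (Subtype.val : O → M) = fun p => (θ (min 0 (sc - h p), p)).1 :=
          funext fun p => hrO p
        rw [heq]
        exact hΘ.continuousAt
      exact (O.isOpen.isOpenEmbedding_subtypeVal.continuousAt_iff).1 key
    · -- near `y`, `r = id` on the open set `{g < c}`
      have hyc : g y < c := lt_of_le_of_lt (not_lt.1 hy) hc
      have hev : id =ᶠ[𝓝 y] r := by
        filter_upwards [(isOpen_lt hg.continuous continuous_const).mem_nhds hyc] with z hz
        exact (hr_id z hz.le).symm
      exact continuousAt_id.congr hev
  -- `{g ≤ c} = r(M)` is preconnected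
  have himage : r '' univ = g ⁻¹' Iic c := by
    apply Subset.antisymm
    · rintro _ ⟨y, -, rfl⟩
      exact hr_le y
    · intro y hy
      exact ⟨y, mem_univ y, hr_id y hy⟩
  rw [← himage]
  exact isPreconnected_univ.image r hr_cont.continuousOn

/-- **Discharge of the named fact `isPreconnected_sublevel_of_forall_mfderiv_ne_zero`**
(Milnor, *Morse theory* (1963), Thm. 3.1): on a connected manifold without boundary, the
sublevel sets `{g ≤ c}`, `c ≥ C`, of a smooth function with compact sublevel sets and no
critical point on `{g ≥ C}` are preconnected — lower `C` a little
(`exists_lt_forall_mfderiv_ne_zero`) and retract (`isPreconnected_preimage_Iic_of_lt`).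
[cite: MilnorMorseTheory1963, Thm. 3.1] -/
theorem isPreconnected_sublevel_of_forall_mfderiv_ne_zero_holds :
    isPreconnected_sublevel_of_forall_mfderiv_ne_zero := by
  intro n M _ _ _ _ _ _ g C hg hK hreg c hCc
  obtain ⟨C', hC'C, hreg'⟩ := exists_lt_forall_mfderiv_ne_zero hg hK hreg
  exact isPreconnected_preimage_Iic_of_lt hg hK hreg' (hC'C.trans_le hCc)

end Literature.Geometry.Symplectic
end
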